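import Summits.FinalStateConjecture.FinalStateConjecture.Theorems.SwallowTheDatumUniversalWitnessFamilyRegionOneBasics

/-!
# Crux `SwallowTheDatum.UniversalWitnessFamily` (stmt-FinalStateConjecture-10051), line `Sketch`,
# stub `stub_regionOneDecomposition` — part 2: real analysis of the explicit functions

Bounds, derivatives, monotonicity and asymptotics of the functions of part 1
(`SwallowTheDatumUniversalWitnessFamilyRegionOneBasics`): the tortoise height `torH`
(`torH_nonneg`, `torH_le`, `torH_le_sqrt`, `hasDerivAt_torH`, `contDiffOn_torH`, `torH_le_torH`,
`tendsto_torH_atTop`), the growth profile (`contDiff_growth`, `growth_le_growth`, `growth_le`,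
`tendsto_growth_div_atTop`, `tendsto_growth_atTop`) and the three radii (monotone, continuous,
smooth, `excision/τ → 0`, `→ ∞`). All proved; no definitions.

References: MTW 1973, §31.4–31.5; O'Neill 1983, Ch. 13.
-/

set_option linter.dupNamespace false

noncomputable section

open scoped Manifold ContDiff Topology
open Set Function Filter Literature.Geometry.Lorentzian

namespace Summit.FinalStateConjecture.FinalStateConjecture.Theorems.SwallowTheDatum.UniversalWitnessFamily

/-! ## The tortoise height -/

/-- `torH M r ≥ 0` for `r ≥ 4M` (`log(r/2M − 1) ≥ log 1 = 0`). -/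
theorem torH_nonneg {M r : ℝ} (hM : 0 < M) (hr : 4 * M ≤ r) : 0 ≤ torH M r := by
  unfold torH
  have h1 : 1 ≤ r / (2 * M) - 1 := by
    rw [le_sub_iff_add_le, le_div_iff₀ (by positivity)]
    linarith
  have := Real.log_nonneg h1
  positivity

/-- `torH M r ≤ 0` for `2M < r ≤ 4M`. -/
theorem torH_nonpos {M r : ℝ} (hM : 0 < M) (hr : 2 * M < r) (hr' : r ≤ 4 * M) : torH M r ≤ 0 := by
  unfold torH
  have h0 : 0 < r / (2 * M) - 1 := div_two_mul_sub_one_pos hM hr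
  have h1 : r / (2 * M) - 1 ≤ 1 := by
    rw [sub_le_iff_le_add, div_le_iff₀ (by positivity)]
    linarith
  have := Real.log_nonpos h0.le h1
  have h2 : 0 ≤ 2 * M := by positivity
  exact mul_nonpos_of_nonneg_of_nonpos h2 this

/-- The crude bound `torH M r ≤ r − 4M < r` for `r > 2M` (`log y ≤ y − 1`). -/
theorem torH_le {M r : ℝ} (hM : 0 < M) (hr : 2 * M < r) : torH M r ≤ r - 4 * M := by
  unfold torH
  have h0 : 0 < r / (2 * M) - 1 := div_two_mul_sub_one_pos hM hr
  have h1 := Real.log_le_sub_one_of_pos h0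
  have h2 : 2 * M * (r / (2 * M) - 1 - 1) = r - 4 * M := by
    field_simp
    ring
  calc 2 * M * Real.log (r / (2 * M) - 1) ≤ 2 * M * (r / (2 * M) - 1 - 1) :=
        mul_le_mul_of_nonneg_left h1 (by positivity)
    _ = r - 4 * M := h2

/-- The sharper bound `torH M r ≤ 4M √(r/2M − 1)` (`log y ≤ 2(√y − 1) < 2√y`). -/
theorem torH_le_sqrt {M r : ℝ} (hM : 0 < M) (hr : 2 * M < r) :
    torH M r ≤ 4 * M * Real.sqrt (r / (2 * M) - 1) := by
  unfold torH
  set y := r / (2 * M) - 1 with hy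
  have h0 : 0 < y := div_two_mul_sub_one_pos hM hr
  have hs : 0 < Real.sqrt y := Real.sqrt_pos.2 h0
  have h1 : Real.log y = 2 * Real.log (Real.sqrt y) := by
    rw [Real.log_sqrt h0.le]
    ring
  have h2 : Real.log (Real.sqrt y) ≤ Real.sqrt y - 1 := Real.log_le_sub_one_of_pos hs
  rw [h1]
  nlinarith [hs]

/-- `torH` has derivative `2M/(r − 2M)` at `r > 2M`. -/
theorem hasDerivAt_torH {M r : ℝ} (hM : 0 < M) (hr : 2 * M < r) :
    HasDerivAt (torH M) (2 * M / (r - 2 * M)) r := by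
  have h0 : 0 < r / (2 * M) - 1 := div_two_mul_sub_one_pos hM hr
  have h1 : HasDerivAt (fun r : ℝ ↦ r / (2 * M) - 1) (1 / (2 * M)) r := by
    simpa using ((hasDerivAt_id r).div_const (2 * M)).sub_const 1
  have h2 := (h1.log h0.ne').const_mul (2 * M)
  have h3 : (fun y : ℝ ↦ 2 * M * Real.log (y / (2 * M) - 1)) = torH M := rfl
  rw [h3] at h2
  refine h2.congr_deriv ?_
  have hr' : r - 2 * M ≠ 0 := by linarith
  field_simp

/-- `torH M` is smooth on `(2M, ∞)`. -/
theorem contDiffOn_torH {M : ℝ} (hM : 0 < M) {n : ℕ∞} :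
    ContDiffOn ℝ n (torH M) (Set.Ioi (2 * M)) := by
  intro r hr
  have h0 : 0 < r / (2 * M) - 1 := div_two_mul_sub_one_pos hM hr
  have h1 : ContDiffAt ℝ n (fun r : ℝ ↦ r / (2 * M) - 1) r :=
    (contDiffAt_id.div_const _).sub contDiffAt_const
  exact ((h1.log h0.ne').const_smul (2 * M)).contDiffWithinAt.congr (fun y _ ↦ by
    simp [torH, smul_eq_mul]) (by simp [torH, smul_eq_mul])

/-- `torH M` is `ContDiffAt` at every `r > 2M`. -/
theorem contDiffAt_torH {M r : ℝ} (hM : 0 < M) (hr : 2 * M < r) {n : ℕ∞} :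
    ContDiffAt ℝ n (torH M) r :=
  (contDiffOn_torH hM).contDiffAt (Ioi_mem_nhds hr)

/-- `torH M` is continuous at every `r > 2M`. -/
theorem continuousAt_torH {M r : ℝ} (hM : 0 < M) (hr : 2 * M < r) : ContinuousAt (torH M) r :=
  (contDiffAt_torH hM hr (n := 0)).continuousAt

/-- `torH M` is monotone on `(2M, ∞)`. -/
theorem torH_le_torH {M r r' : ℝ} (hM : 0 < M) (hr : 2 * M < r) (hrr' : r ≤ r') :
    torH M r ≤ torH M r' := by
  unfold torH
  have h0 : 0 < r / (2 * M) - 1 := div_two_mul_sub_one_pos hM hr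
  refine mul_le_mul_of_nonneg_left (Real.log_le_log h0 ?_) (by positivity)
  have : r / (2 * M) ≤ r' / (2 * M) := div_le_div_of_nonneg_right hrr' (by positivity)
  linarith

/-- `torH M r → +∞` as `r → +∞`. -/
theorem tendsto_torH_atTop {M : ℝ} (hM : 0 < M) : Tendsto (torH M) atTop atTop := by
  unfold torH
  refine Tendsto.const_mul_atTop (by positivity) ?_
  refine Real.tendsto_log_atTop.comp ?_
  refine tendsto_atTop_add_const_right _ (-1) ?_
  exact Tendsto.atTop_div_const (by positivity) tendsto_id


/-! ## The growth profile -/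

/-- `growth M` is continuous. -/
theorem continuous_growth (M : ℝ) : Continuous (growth M) := by
  unfold growth
  fun_prop

/-- `growth M` is smooth (the inner radicands are `≥ 1 > 0`). -/
theorem contDiff_growth (M : ℝ) {n : ℕ∞} : ContDiff ℝ n (growth M) := by
  unfold growth
  refine contDiff_const.mul ?_
  refine ContDiff.sqrt ?_ fun τ ↦ ?_
  · refine ContDiff.sqrt (contDiff_const.add ((contDiff_id.div_const M).pow 2)) fun τ ↦ ?_
    nlinarith [sq_nonneg (τ / M)]
  · have h1 : 1 ≤ 1 + (τ / M) ^ 2 := by nlinarith [sq_nonneg (τ / M)]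
    have : 0 < Real.sqrt (1 + (τ / M) ^ 2) := Real.sqrt_pos.2 (by linarith)
    exact this.ne'

/-- `growth M` is monotone on `[0, ∞)`. -/
theorem growth_le_growth {M : ℝ} (hM : 0 < M) {τ τ' : ℝ} (h0 : 0 ≤ τ) (h : τ ≤ τ') :
    growth M τ ≤ growth M τ' := by
  unfold growth
  refine mul_le_mul_of_nonneg_left (Real.sqrt_le_sqrt (Real.sqrt_le_sqrt ?_)) hM.le
  have : τ / M ≤ τ' / M := div_le_div_of_nonneg_right h hM.le
  have h0' : 0 ≤ τ / M := div_nonneg h0 hM.le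
  nlinarith

/-- `growth M τ ≤ M + √M √τ`-type bound: `growth M τ ≤ M * (1 + √(τ/M))` for `τ ≥ 0`
(`(1 + s²)^{1/4} ≤ 1 + √s`). -/
theorem growth_le {M : ℝ} (hM : 0 < M) {τ : ℝ} (hτ : 0 ≤ τ) :
    growth M τ ≤ M * (1 + Real.sqrt (τ / M)) := by
  unfold growth
  refine mul_le_mul_of_nonneg_left ?_ hM.le
  set s := τ / M with hs
  have hs0 : 0 ≤ s := div_nonneg hτ hM.le
  have hq : 0 ≤ Real.sqrt s := Real.sqrt_nonneg _
  -- `(1 + √s)^4 ≥ 1 + s²`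
  have key : 1 + s ^ 2 ≤ (1 + Real.sqrt s) ^ 4 := by
    have e : Real.sqrt s ^ 2 = s := Real.sq_sqrt hs0
    nlinarith [e, hq, sq_nonneg (Real.sqrt s), mul_nonneg hq hs0]
  have h1 : Real.sqrt (1 + s ^ 2) ≤ (1 + Real.sqrt s) ^ 2 := by
    rw [show (1 + Real.sqrt s) ^ 2 = Real.sqrt (((1 + Real.sqrt s) ^ 2) ^ 2) by
      rw [Real.sqrt_sq (by positivity)]]
    exact Real.sqrt_le_sqrt (by nlinarith [key])
  calc Real.sqrt (Real.sqrt (1 + s ^ 2)) ≤ Real.sqrt ((1 + Real.sqrt s) ^ 2) := Real.sqrt_le_sqrt h1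
    _ = 1 + Real.sqrt s := Real.sqrt_sq (by positivity)

/-- `growth M τ / τ → 0`. -/
theorem tendsto_growth_div_atTop {M : ℝ} (hM : 0 < M) :
    Tendsto (fun τ ↦ growth M τ / τ) atTop (𝓝 0) := by
  -- squeeze between `0` and `M(1 + √(τ/M))/τ`
  have hup : Tendsto (fun τ : ℝ ↦ M * (1 + Real.sqrt (τ / M)) / τ) atTop (𝓝 0) := by
    have e : ∀ τ : ℝ, 0 < τ → M * (1 + Real.sqrt (τ / M)) / τ = M / τ + Real.sqrt M * (Real.sqrt τ / τ) := by
      intro τ hτ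
      rw [Real.sqrt_div' τ hM.le]  -- √(τ/M) = √τ/√M
      have hsM : Real.sqrt M ≠ 0 := (Real.sqrt_pos.2 hM).ne'
      have hMM : M = Real.sqrt M * Real.sqrt M := (Real.mul_self_sqrt hM.le).symm
      field_simp
      nlinarith [Real.mul_self_sqrt hM.le, Real.sqrt_nonneg M, Real.sqrt_nonneg τ]
    have h1 : Tendsto (fun τ : ℝ ↦ M / τ) atTop (𝓝 0) := tendsto_const_nhds.div_atTop tendsto_id
    have h2 : Tendsto (fun τ : ℝ ↦ Real.sqrt M * (Real.sqrt τ / τ)) atTop (𝓝 0) := by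
      have : Tendsto (fun τ : ℝ ↦ Real.sqrt τ / τ) atTop (𝓝 0) := by
        simp_rw [Real.sqrt_div_self]
        exact tendsto_inv_atTop_zero.comp Real.tendsto_sqrt_atTop
      simpa using this.const_mul (Real.sqrt M)
    have h3 := h1.add h2
    rw [add_zero] at h3
    refine h3.congr' ?_
    filter_upwards [eventually_gt_atTop 0] with τ hτ
    exact (e τ hτ).symm
  refine tendsto_of_tendsto_of_tendsto_of_le_of_le' tendsto_const_nhds hup ?_ ?_
  · filter_upwards [eventually_gt_atTop 0] with τ hτ
    exact div_nonneg (growth_pos hM τ).le hτ.le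
  · filter_upwards [eventually_gt_atTop 0] with τ hτ
    exact div_le_div_of_nonneg_right (growth_le hM hτ.le) hτ.le

/-- `growth M τ → ∞`. -/
theorem tendsto_growth_atTop {M : ℝ} (hM : 0 < M) : Tendsto (growth M) atTop atTop := by
  -- `growth M τ ≥ M √(τ/M)·… `; simplest: `growth M τ ≥ √(M τ)`-free argument via `(1+s²)^{1/4} ≥ √s`
  have hlow : ∀ τ : ℝ, 0 ≤ τ → M * Real.sqrt (Real.sqrt ((τ / M) ^ 2)) ≤ growth M τ := by
    intro τ hτ
    unfold growth
    refine mul_le_mul_of_nonneg_left (Real.sqrt_le_sqrt (Real.sqrt_le_sqrt (by linarith))) hM.le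
  have h2 : Tendsto (fun τ : ℝ ↦ M * Real.sqrt (Real.sqrt ((τ / M) ^ 2))) atTop atTop := by
    refine Tendsto.const_mul_atTop hM ?_
    refine Real.tendsto_sqrt_atTop.comp (Real.tendsto_sqrt_atTop.comp ?_)
    refine (tendsto_pow_atTop two_ne_zero).comp ?_
    exact Tendsto.atTop_div_const hM tendsto_id
  refine tendsto_atTop_mono' atTop ?_ h2
  filter_upwards [eventually_ge_atTop 0] with τ hτ
  exact hlow τ hτ


/-! ## The radii -/

/-- The flat excision radius is monotone on `[0, ∞)`. -/
theorem excision_le_excision {M : ℝ} (hM : 0 < M) {τ τ' : ℝ} (h0 : 0 ≤ τ) (h : τ ≤ τ') :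
    excision M τ ≤ excision M τ' := by
  unfold excision; linarith [growth_le_growth hM h0 h]

/-- The certified hole radius is monotone on `[0, ∞)`. -/
theorem certRadius_le_certRadius {M : ℝ} (hM : 0 < M) {τ τ' : ℝ} (h0 : 0 ≤ τ) (h : τ ≤ τ') :
    certRadius M τ ≤ certRadius M τ' := by
  unfold certRadius; linarith [growth_le_growth hM h0 h]

/-- The flat excision radius is continuous. -/
theorem continuous_excision (M : ℝ) : Continuous (excision M) :=
  continuous_const.add (continuous_growth M)

/-- The exact-zone radius is continuous. -/
theorem continuous_exactRadius (M : ℝ) : Continuous (exactRadius M) :=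
  continuous_const.add (continuous_const.mul (continuous_growth M))

/-- The exact-zone radius is smooth. -/
theorem contDiff_exactRadius (M : ℝ) {n : ℕ∞} : ContDiff ℝ n (exactRadius M) :=
  contDiff_const.add (contDiff_const.mul (contDiff_growth M))

/-- The flat excision radius is sublinear: `ρ(τ)/τ → 0`. -/
theorem tendsto_excision_div_atTop {M : ℝ} (hM : 0 < M) :
    Tendsto (fun τ ↦ excision M τ / τ) atTop (𝓝 0) := by
  have h1 : Tendsto (fun τ : ℝ ↦ 4 * M / τ) atTop (𝓝 0) := tendsto_const_nhds.div_atTop tendsto_id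
  have h2 := h1.add (tendsto_growth_div_atTop hM)
  rw [add_zero] at h2
  refine h2.congr fun τ ↦ ?_
  unfold excision
  rw [add_div]

/-- The flat excision radius tends to infinity. -/
theorem tendsto_excision_atTop {M : ℝ} (hM : 0 < M) : Tendsto (excision M) atTop atTop :=
  tendsto_atTop_add_const_left _ _ (tendsto_growth_atTop hM)

/-- The exact-zone radius tends to infinity. -/
theorem tendsto_exactRadius_atTop {M : ℝ} (hM : 0 < M) : Tendsto (exactRadius M) atTop atTop :=
  tendsto_atTop_add_const_left _ _ (Tendsto.const_mul_atTop (by norm_num) (tendsto_growth_atTop hM))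

/-! ## Membership in the Schwarzschild exterior `Kerr.region 0 (2M)` -/

section Region

variable {M : ℝ}

/-- `x ∈ Kerr.region 0 (r₊(M, 0))` iff `‖x̃‖ > 2M` (`r₊ = 2M`, `r = ‖x̃‖` for `a = 0`). -/
theorem mem_region_iff (hM : 0 ≤ M) {x : E4} :
    x ∈ Kerr.region 0 (Kerr.rPlus M 0) ↔ 2 * M < E4.spatialNorm x := by
  rw [Kerr.mem_region, Kerr.radius_zero_left, Kerr.rPlus_zero_right hM, max_eq_left (by linarith)]

/-- Points of the Schwarzschild exterior have `‖x̃‖ > 2M`. -/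
theorem two_mul_lt_spatialNorm (hM : 0 ≤ M) (x : Kerr.region 0 (Kerr.rPlus M 0)) :
    2 * M < E4.spatialNorm x.1 :=
  (mem_region_iff hM).1 x.2

/-- Points of the Schwarzschild exterior lie off the time axis. -/
theorem spatialNorm_pos (hM : 0 ≤ M) (x : Kerr.region 0 (Kerr.rPlus M 0)) :
    0 < E4.spatialNorm x.1 := by
  linarith [two_mul_lt_spatialNorm hM x]

/-- The Kerr–Schild radius is positive on the exterior. -/
theorem radius_pos (hM : 0 ≤ M) (x : Kerr.region 0 (Kerr.rPlus M 0)) : 0 < Kerr.radius 0 x.1 := by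
  rw [Kerr.radius_zero_left]; exact spatialNorm_pos hM x

end Region

/-- Registered anchor of this helper file (M2 part 2): the tortoise shift is monotone on the
exterior and tends to `+∞`, and the excision radius tends to `+∞`. -/
theorem regionOneAnalysis_anchor : ∀ (M : ℝ), 0 < M →
    (∀ r r' : ℝ, 2 * M < r → r ≤ r' → torH M r ≤ torH M r') ∧
      Filter.Tendsto (torH M) Filter.atTop Filter.atTop ∧
        Filter.Tendsto (excision M) Filter.atTop Filter.atTop := by
  intro M hM
  exact ⟨fun r r' hr hrr' ↦ torH_le_torH hM hr hrr', tendsto_torH_atTop hM,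
    tendsto_excision_atTop hM⟩

end Summit.FinalStateConjecture.FinalStateConjecture.Theorems.SwallowTheDatum.UniversalWitnessFamily

end
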